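import Summits.Parity.GeneralizedHardyLittlewood.Theorems.GreenTaoLevelTwoMNTwoPropNineteenOfInverse

/-!
# Route `GreenTaoLevelTwo`, crux `MNTwo` (stmt-Parity-21276), line `birth`, stub `stub_mnVertical`:
# the major-arc inverse statement `hInv`, AS TYPED, is false (interface repair note)

The hypothesis `hInv k` of `…MNTwoPropNineteenOfInverse.propNineteen_of_majorArcInverse` (and,
quantified over all `k`, of `…MNTwoVerticalOfInverse.stub_mnVertical_of_majorArcInverse`) demands
in its conclusion `(log^B N)⁻¹ ≤ ρ₃ ≤ ρ` with `B` chosen BEFORE `N` and `ρ`, while its hypotheses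
put no lower bound on `ρ`: for moderate `N` (with `N² ≤ log^A N`, e.g. `N = 100`, `A = 10`) the
"large sum" hypothesis `N/log^A N ≤ ‖Σ μψe(−φ)‖` is met by `ψ = N⁻¹·1_{n₀}`, `φ = 0`, which satisfy
the support and (discrete) Lipschitz hypotheses for EVERY `ρ > 0`; taking `ρ < (log^B N)⁻¹`
contradicts the conclusion.  (In the source, B. Green, T. Tao, *Quadratic uniformity of the Möbius
function*, Ann. Inst. Fourier 58 (2008) = arXiv:math/0606087, §10 eq. (r-big) "`ρ₀ ≳ 1`" is DERIVED
from `‖ψ‖_∞ ≪ ρ₀`, a consequence of `ψ` being the restriction of a Lipschitz function on the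
continuous torus — information the typed `hInv` does not retain.)  REPAIR: add to `hInv` the
hypothesis `(Real.log N ^ A')⁻¹ ≤ ρ` (any fixed `A' ≥ A + 3` works downstream: for
`N > 3 log^A N` the large sum forces `ρ ≥ 1/(6 log^A N)`, and the finitely many smaller `N` are
absorbed in the constant of Proposition 19), and re-derive Proposition 19 from the repaired
statement.  This def-free file records the refutation so that no seat targets `∀ k, hInv k`.

* `not_forall_majorArcInverse` — `¬ (∀ k, hInv k)` (the hypothesis of
  `stub_mnVertical_of_majorArcInverse`, verbatim), witnessed at `k = 0`, `A = 10`, `N = 100`.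

References: [GreenTao2008QuadraticMobius] arXiv:math/0606087 §10 (r-big), Prop. 19, §§9–12.
-/

noncomputable section

open Finset Real ArithmeticFunction
open scoped ArithmeticFunction.Moebius FourierTransform

namespace Summit.Parity.GeneralizedHardyLittlewood.GreenTaoLevelTwoMNTwoMajorArcInverseFalse

/-- `4 ≤ log 100`. [folklore] -/
theorem four_le_log_hundred : (4 : ℝ) ≤ Real.log 100 := by
  rw [Real.le_log_iff_exp_le (by norm_num)]
  have h1 := Real.exp_one_lt_d9
  have h4 : Real.exp 4 = Real.exp 1 ^ 4 := by
    rw [← Real.exp_nat_mul]; norm_num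
  rw [h4]
  calc Real.exp 1 ^ 4 ≤ (2.7182818286 : ℝ) ^ 4 :=
        pow_le_pow_left₀ (Real.exp_pos _).le h1.le 4
    _ ≤ 100 := by norm_num

/-- **The typed major-arc inverse statement is false** (see the module docstring for the witness
and the repair). [cite: GreenTao2008QuadraticMobius, §10 eq. (r-big) and Prop. 19] -/
theorem not_forall_majorArcInverse :
    ¬ (∀ k : ℕ, ∀ A : ℝ, 0 < A → ∃ B : ℝ, 0 ≤ B ∧ ∀ N : ℕ, 2 ≤ N → ∀ (α : Fin k → ℝ) (n₀ : ℤ)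
      (ρ : ℝ), 0 < ρ → 100000 * ρ < 1 →
      (∀ n : ℤ, ((∀ i, ‖((((n - n₀ : ℤ) : ℝ) * α i : ℝ) : AddCircle (1 : ℝ))‖ +
          |((n - n₀ : ℤ) : ℝ)| / N < 100 * ρ) ∧ |((n - n₀ : ℤ) : ℝ)| / N < 100 * ρ) →
        (N : ℤ) < n ∧ n ≤ 2 * N) →
      ∀ φ : ℤ → ℝ,
        (∀ n h₁ h₂ h₃ : ℤ,
          (∀ e₁ e₂ e₃ : ℕ, e₁ ≤ 1 → e₂ ≤ 1 → e₃ ≤ 1 →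
            (∀ i, ‖((((n + e₁ * h₁ + e₂ * h₂ + e₃ * h₃ - n₀ : ℤ) : ℝ) * α i : ℝ) :
                AddCircle (1 : ℝ))‖ +
              |((n + e₁ * h₁ + e₂ * h₂ + e₃ * h₃ - n₀ : ℤ) : ℝ)| / N < 100 * ρ) ∧
            |((n + e₁ * h₁ + e₂ * h₂ + e₃ * h₃ - n₀ : ℤ) : ℝ)| / N < 100 * ρ) →
          ∃ z : ℤ, φ (n + h₁ + h₂ + h₃) - φ (n + h₁ + h₂) - φ (n + h₁ + h₃) - φ (n + h₂ + h₃)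
            + φ (n + h₁) + φ (n + h₂) + φ (n + h₃) - φ n = z) →
        ∀ ψ : ℤ → ℝ, (∀ n, 0 ≤ ψ n) →
          (∀ n, ψ n ≠ 0 →
            (∀ i, ‖((((n - n₀ : ℤ) : ℝ) * α i : ℝ) : AddCircle (1 : ℝ))‖ +
                |((n - n₀ : ℤ) : ℝ)| / N < ρ) ∧ |((n - n₀ : ℤ) : ℝ)| / N < ρ) →
          (∀ (n n' : ℤ) (t : ℝ), 0 ≤ t →
            (∀ i, ‖((((n - n' : ℤ) : ℝ) * α i : ℝ) : AddCircle (1 : ℝ))‖ ≤ t) →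
              |ψ n - ψ n'| ≤ t + |((n - n' : ℤ) : ℝ)| / N) →
          (N : ℝ) / Real.log N ^ A ≤
            ‖∑ n ∈ Ioc N (2 * N), ((μ n : ℝ) : ℂ) * ((ψ n : ℝ) : ℂ) * (𝐞 (-(φ n)) : ℂ)‖ →
          ∃ (q : ℕ) (K ρ₃ : ℝ), 1 ≤ q ∧ (q : ℝ) ≤ Real.log N ^ B ∧ 0 ≤ K ∧ K ≤ Real.log N ^ B ∧
            (Real.log N ^ B)⁻¹ ≤ ρ₃ ∧ ρ₃ ≤ ρ ∧
            ∀ a b : ℤ,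
              (⨆ i : Fin k, ‖(((a : ℝ) * α i : ℝ) : AddCircle (1 : ℝ))‖) + |(a : ℝ)| / N < ρ₃ →
              (⨆ i : Fin k, ‖(((b : ℝ) * α i : ℝ) : AddCircle (1 : ℝ))‖) + |(b : ℝ)| / N < ρ₃ →
              ‖q • ((((φ (n₀ + a + b) : ℝ) : UnitAddCircle)) - ((φ (n₀ + a) : ℝ) : UnitAddCircle)
                - ((φ (n₀ + b) : ℝ) : UnitAddCircle) + ((φ n₀ : ℝ) : UnitAddCircle))‖ ≤
                K * ((⨆ i : Fin k, ‖(((a : ℝ) * α i : ℝ) : AddCircle (1 : ℝ))‖) + |(a : ℝ)| / N) *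
                  ((⨆ i : Fin k, ‖(((b : ℝ) * α i : ℝ) : AddCircle (1 : ℝ))‖) + |(b : ℝ)| / N)) := by
  intro h
  obtain ⟨B, -, hB⟩ := h 0 10 (by norm_num)
  have hL4 : (4 : ℝ) ≤ Real.log ((100 : ℕ) : ℝ) := by
    rw [Nat.cast_ofNat]; exact four_le_log_hundred
  have hLpos : 0 < Real.log ((100 : ℕ) : ℝ) := by linarith
  have hLB : 0 < Real.log ((100 : ℕ) : ℝ) ^ B := Real.rpow_pos_of_pos hLpos B
  set ρ : ℝ := min (1 / 1000000) ((Real.log ((100 : ℕ) : ℝ) ^ B)⁻¹ / 2) with hρdef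
  have hρpos : 0 < ρ := lt_min (by norm_num) (by positivity)
  have hρ1 : ρ ≤ 1 / 1000000 := min_le_left _ _
  have hρ2 : ρ ≤ (Real.log ((100 : ℕ) : ℝ) ^ B)⁻¹ / 2 := min_le_right _ _
  set ψ : ℤ → ℝ := fun n => if n = 101 then 1 / 100 else 0 with hψdef
  have hψ0 : ∀ n, 0 ≤ ψ n := fun n => by
    simp only [hψdef]; split_ifs <;> norm_num
  have hψle : ∀ n, ψ n ≤ 1 / 100 := fun n => by
    simp only [hψdef]; split_ifs <;> norm_num
  obtain ⟨q, K, ρ₃, -, -, -, -, hρ₃B, hρ₃ρ, -⟩ := hB 100 (by norm_num) (fun i => i.elim0) 101 ρ hρpos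
    (by linarith)
    (by
      rintro n ⟨-, h2⟩
      rw [Nat.cast_ofNat] at h2
      have h3 : |((n - 101 : ℤ) : ℝ)| < 1 := by
        rw [div_lt_iff₀ (by norm_num : (0 : ℝ) < 100)] at h2
        nlinarith
      rw [← Int.cast_abs] at h3
      have h4 : |n - 101| < 1 := by exact_mod_cast h3
      rw [Int.abs_lt_one_iff] at h4
      constructor <;> push_cast <;> omega)
    (fun _ => 0)
    (fun _ _ _ _ _ => ⟨0, by norm_num⟩)
    ψ hψ0
    (by
      intro n hn
      have h101 : n = 101 := by
        by_contra hne
        exact hn (by simp only [hψdef, if_neg hne])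
      subst h101
      refine ⟨fun i => i.elim0, ?_⟩
      simp [hρpos])
    (by
      intro n n' t ht _
      by_cases hnn : n = n'
      · subst hnn; simp only [sub_self, abs_zero]; positivity
      · have h1 : (1 : ℝ) ≤ |((n - n' : ℤ) : ℝ)| := by
          rw [← Int.cast_abs]
          exact_mod_cast Int.one_le_abs (sub_ne_zero.2 hnn)
        have h2 : |ψ n - ψ n'| ≤ 1 / 100 := by
          rw [abs_sub_le_iff]
          constructor <;> linarith [hψ0 n, hψ0 n', hψle n, hψle n']
        rw [Nat.cast_ofNat]
        have : (1 : ℝ) / 100 ≤ |((n - n' : ℤ) : ℝ)| / 100 := by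
          rw [div_le_div_iff_of_pos_right (by norm_num)]; exact h1
        linarith)
    (by
      -- the sum is the single term `n = 101`: `‖μ(101)·(1/100)·e(0)‖ = 1/100`
      have hsum : ∑ n ∈ Ioc (100 : ℕ) (2 * 100), ((μ n : ℝ) : ℂ) * ((ψ n : ℝ) : ℂ) *
          (𝐞 (-((fun _ : ℤ => (0 : ℝ)) n)) : ℂ) = ((μ 101 : ℝ) : ℂ) * (((1 / 100 : ℝ)) : ℂ) := by
        rw [Finset.sum_eq_single 101]
        · simp [hψdef]
        · intro n _ hn
          have : ψ n = 0 := by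
            simp only [hψdef]
            rw [if_neg (by exact_mod_cast hn)]
          rw [this]; simp
        · intro h; exact absurd (by simp) h
      rw [hsum]
      have hμ : μ 101 = -1 := ArithmeticFunction.moebius_apply_prime (by norm_num)
      rw [hμ, norm_mul, Complex.norm_real, Complex.norm_real]
      norm_num
      -- `100 / log 100 ^ 10 ≤ 1/100`
      have hpow : Real.log (100 : ℝ) ^ ((10 : ℕ) : ℝ) = Real.log 100 ^ (10 : ℕ) :=
        Real.rpow_natCast _ 10
      norm_num at hpow
      try rw [hpow]
      rw [div_le_iff₀ (by positivity)]
      have h4 := four_le_log_hundred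
      have : (4 : ℝ) ^ 10 ≤ Real.log 100 ^ 10 := pow_le_pow_left₀ (by norm_num) h4 10
      nlinarith)
  -- contradiction: `(log^B 100)⁻¹ ≤ ρ₃ ≤ ρ ≤ (log^B 100)⁻¹/2`
  have := hρ₃B.trans (hρ₃ρ.trans hρ2)
  linarith [inv_pos.2 hLB]

end Summit.Parity.GeneralizedHardyLittlewood.GreenTaoLevelTwoMNTwoMajorArcInverseFalse
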